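import Mathlib.Analysis.SpecialFunctions.Exponential
import Mathlib.Analysis.Normed.Ring.Units
import Mathlib.Analysis.Matrix.Normed
import Literature.NumberTheory.Automorphic.ArchimedeanCalculusRegular
import HarnessLib

/-!
# The logarithm of a differentiable curve in a linear real group (and in its maximal compact subgroup) near a point

Topic `NumberTheory/Automorphic`; namespace `Literature.NumberTheory.Automorphic.IsGKModule` (helper of the `(𝔤, K)`-calculus); sequel
`GKModulesKActionAlongCurves`.  Cell `hodgecm-mathlib`, F0∕P3, ROAD-GLOB to the letter A6 #92 `HasUnitaryGlobalizationOfInfUnitary` at `U(2,1)`,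
brick **«KD»** (LEAD F0P3b-p01 (g3) WANTED 2026-08-31T20:56:39Z: «also export the two log-derivative facts»), second file of three.  Theorems only;
no definition, no named fact, no instance, no notation, no `sorry`.

THE MATHEMATICS ([Hall2015, Thm. 3.42, Cor. 3.44]; [Knapp2002, I.§10 Prop. 1.89]).  Let `G` be a linear real group over a finite-dimensional coefficient
algebra with FULL Lie algebra (`hreg`, e.g. ★ `uFormGroup_regular`), and `log` the two-sided local logarithm of ★ `exists_contDiffAt_log_inverse`
(`D log (1) = id`: `hasFDerivAt_log_one`).  For a curve `g : ℝ → G` (resp. `k : ℝ → K = G ∩ U(N)`) whose MATRIX has derivative `g′` at `s₀`, the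
function `L s := log (g(s₀)⁻¹ g(s))` has `L s₀ = 0`, `HasDerivAt L (g(s₀)⁻¹ g′) s₀`, and for `s` near `s₀`: `L s ∈ 𝔤` and `g s = g s₀ · exp (L s)`
(`exists_log_curve_carrier`; ★ `RealMatrixGroup.eventually_nhds_one_log_mem` = von Neumann–Cartan, after checking that the curve is continuous INTO
`GL` — inverse matrices by `NormedRing.inverse_continuousAt`, resp. by `star` for unitary curves); for `K`-valued curves moreover `L s ∈ 𝔨 = 𝔤 ∩ 𝔲(N)`
(`exists_log_curve'`: `exp (star L) = star (exp L) = (exp L)⁻¹ = exp (−L)` and injectivity of `exp` near `0`).  Consequently the LEFT LOG-DERIVATIVES lie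
in the Lie algebras: **`g(s₀)⁻¹ g′ ∈ 𝔤`** (`inv_mul_deriv_mem_lie`) and **`k(s₀)⁻¹ k′ ∈ 𝔨`** (`inv_mul_deriv_mem_compactLie`), the subalgebras being closed;
and the log-derivative form `exists_log_curve` (`k′ = k(s₀) Y`, `Y ∈ 𝔨`).

HONEST LABEL: helper brick; closes no registered stub.  HC_CM is proved only modulo the 2 remaining named inputs (hLiu418, h413) until rung 0 closes.

## Mathlib ∕ tree search
Mathlib: `ContDiffAt.differentiableAt`, `HasFDerivAt.comp_hasDerivAt`, `HasFDerivAt.unique`, `hasFDerivAt_exp_zero`, `Units.isInducing_embedProduct`,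
`Units.inv_eq_of_mul_eq_one_left`, `Ring.inverse_unit`, `NormedRing.inverse_continuousAt`, `NormedSpace.star_exp`, `Matrix.exp_neg`, `Matrix.inv_eq_left_inv`,
`Submodule.closed_of_finiteDimensional`, `HasDerivAt.tendsto_slope`.  Tree: ★ `exists_contDiffAt_log_inverse`, ★ `RealMatrixGroup.eventually_nhds_one_log_mem`,
★ `mem_unitarySubgroupGL_iff`, ★ `RealMatrixGroup.mem_compactLie_iff`∕`coe_expK`∕`coe_expMem`.  Dedup: `rg "exists_log_curve|inv_mul_deriv_mem"` over
`Literature/` — no hits.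

## References
* B. C. Hall, *Lie Groups, Lie Algebras, and Representations*, 2nd ed., GTM 222 (2015), Thm. 3.42, Cor. 3.44 [Hall2015].
* A. W. Knapp, *Lie Groups Beyond an Introduction*, 2nd ed. (2002), I.§10, Prop. 1.89 [Knapp2002].
-/

set_option autoImplicit false

noncomputable section

open Filter Topology Finset Matrix
open scoped Nat Matrix.Norms.Operator ContDiff

namespace Literature.NumberTheory.Automorphic

namespace IsGKModule

variable {A : Type*} [NormedCommRing A] [NormedAlgebra ℝ A] [NormedAlgebra ℚ A] [CompleteSpace A]
  [StarRing A] [StarModule ℝ A] [ContinuousStar A] {N : Type*} [Fintype N] [DecidableEq N]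
  {G : RealMatrixGroup A N}

/-! ## §3 The logarithm of a differentiable curve in `K` near a point -/

section LogChart

variable [FiniteDimensional ℝ A]

omit [NormedAlgebra ℚ A] [CompleteSpace A] [StarRing A] [StarModule ℝ A] [ContinuousStar A] in
/-- The local logarithm has derivative `id` at `1` (differentiate `log ∘ exp = id` at `0`). [cite: Hall2015, Cor. 3.44] -/
theorem hasFDerivAt_log_one {log : Matrix N N A → Matrix N N A} (hlog : ContDiffAt ℝ ∞ log 1)
    (hleft : ∀ᶠ x in 𝓝 (0 : Matrix N N A), log (NormedSpace.exp x) = x) :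
    HasFDerivAt log (ContinuousLinearMap.id ℝ (Matrix N N A)) 1 := by
  have hd : HasFDerivAt log (fderiv ℝ log 1) 1 := (hlog.differentiableAt (by simp)).hasFDerivAt
  have hexp0 : HasFDerivAt (NormedSpace.exp : Matrix N N A → Matrix N N A) (ContinuousLinearMap.id ℝ (Matrix N N A)) 0 :=
    (hasFDerivAt_exp_zero (𝕂 := ℝ) (𝔸 := Matrix N N A)).congr_fderiv ContinuousLinearMap.one_def
  have hcomp : HasFDerivAt (fun x => log (NormedSpace.exp x)) ((fderiv ℝ log 1).comp (ContinuousLinearMap.id ℝ _)) 0 := by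
    have hd' : HasFDerivAt log (fderiv ℝ log 1) (NormedSpace.exp (0 : Matrix N N A)) := by rwa [NormedSpace.exp_zero]
    exact hd'.comp 0 hexp0
  have hid : HasFDerivAt (fun x : Matrix N N A => x) (ContinuousLinearMap.id ℝ _) 0 := hasFDerivAt_id 0
  have hcomp' : HasFDerivAt (fun x : Matrix N N A => x) ((fderiv ℝ log 1).comp (ContinuousLinearMap.id ℝ _)) 0 :=
    hcomp.congr_of_eventuallyEq (hleft.mono fun x hx => hx.symm)
  have heq : fderiv ℝ log 1 = ContinuousLinearMap.id ℝ _ := by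
    have h1 := hcomp'.unique hid
    simpa using h1
  rwa [heq] at hd

/-- **The logarithm of a `K`-valued curve.**  For a regular linear real group over a finite-dimensional coefficient algebra and a curve
`k : ℝ → K` whose matrix has derivative `k'` at `s₀`, there is `L : ℝ → 𝔤𝔩` with `L s₀ = 0`, `HasDerivAt L (k(s₀)⁻¹ k') s₀`, and,
for `s` near `s₀`, `L s ∈ 𝔨` and `k s = k s₀ · expK (L s)`. (Local logarithm ★ `exists_contDiffAt_log_inverse`; `log` of elements of `G`
near `1` lies in `𝔤`, ★ `RealMatrixGroup.eventually_nhds_one_log_mem`; `log` of a unitary near `1` is skew-Hermitian since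
`exp (star L) = star (exp L) = (exp L)⁻¹ = exp (−L)`.) [cite: Hall2015, Cor. 3.44] [cite: Knapp2002, I.§10 Prop. 1.89] -/
theorem exists_log_curve' (hreg : ∀ X : Matrix N N A, (∀ t : ℝ, expGL (t • X) ∈ G.carrier) → X ∈ G.lie)
    {k : ℝ → G.maximalCompact} {s₀ : ℝ} {k' : Matrix N N A}
    (hk : HasDerivAt (fun s => (((k s : G.maximalCompact) : GL N A) : Matrix N N A)) k' s₀) :
    ∃ L : ℝ → Matrix N N A, L s₀ = 0 ∧
      HasDerivAt L (((((k s₀)⁻¹ : G.maximalCompact) : GL N A) : Matrix N N A) * k') s₀ ∧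
      ∀ᶠ s in 𝓝 s₀, ∃ hL : L s ∈ G.compactLie, k s = k s₀ * G.expK ⟨L s, hL⟩ := by
  obtain ⟨log, hlog, hlog1, hright, hleft⟩ := exists_contDiffAt_log_inverse (A := A) (N := N)
  -- the matrix of `m s := (k s₀)⁻¹ k s`, its derivative `Y` at `s₀`, its value `1` there
  set P : Matrix N N A := ((((k s₀)⁻¹ : G.maximalCompact) : GL N A) : Matrix N N A) with hP
  set Mf : ℝ → Matrix N N A := fun s => P * (((k s : G.maximalCompact) : GL N A) : Matrix N N A) with hMf
  have hPK : P * (((k s₀ : G.maximalCompact) : GL N A) : Matrix N N A) = 1 := by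
    rw [hP, ← Units.val_mul, ← Subgroup.coe_mul, inv_mul_cancel]; rfl
  have hMf0 : Mf s₀ = 1 := hPK
  have hMf' : HasDerivAt Mf (P * k') s₀ := hk.const_mul P
  -- `L := log ∘ Mf`
  refine ⟨fun s => log (Mf s), by show log (Mf s₀) = 0; rw [hMf0, hlog1], ?_, ?_⟩
  · have hlog' := hasFDerivAt_log_one hlog hleft
    rw [← hMf0] at hlog'
    exact (hlog'.comp_hasDerivAt s₀ hMf').congr_deriv rfl
  · -- `m s → 1` in `G.carrier`
    have hval_cont : ContinuousAt Mf s₀ := hMf'.continuousAt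
    let m : ℝ → G.carrier := fun s => ⟨(((k s₀)⁻¹ * k s : G.maximalCompact) : GL N A), ((k s₀)⁻¹ * k s).2.1⟩
    have hm_val : ∀ s, (((m s : G.carrier) : GL N A) : Matrix N N A) = Mf s := fun s => by
      simp only [m, hMf, hP, Subgroup.coe_mul, Units.val_mul]
    -- inverse matrices: `star`, by unitarity
    have hunit : ∀ s, star (Mf s) * Mf s = 1 := fun s => by
      have hu := (mem_unitarySubgroupGL_iff _).mp ((k s₀)⁻¹ * k s).2.2
      rw [← hm_val]
      exact hu
    have hm_inv : ∀ s, ((((m s : G.carrier) : GL N A)⁻¹ : GL N A) : Matrix N N A) = star (Mf s) := fun s =>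
      Units.inv_eq_of_mul_eq_one_left (by rw [hm_val]; exact hunit s)
    have hm_cont : ContinuousAt m s₀ := by
      show Tendsto m (𝓝 s₀) (𝓝 (m s₀))
      have hind : IsInducing (fun g : G.carrier => Units.embedProduct (Matrix N N A) (g : GL N A)) :=
        Units.isInducing_embedProduct.comp ⟨rfl⟩
      rw [hind.nhds_eq_comap, Filter.tendsto_comap_iff]
      have h1 : Tendsto (fun s => Mf s) (𝓝 s₀) (𝓝 (Mf s₀)) := hval_cont
      have h2 : Tendsto (fun s => MulOpposite.op (star (Mf s))) (𝓝 s₀) (𝓝 (MulOpposite.op (star (Mf s₀)))) :=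
        (MulOpposite.continuous_op.tendsto _).comp ((continuous_star.tendsto _).comp hval_cont)
      have h12 := h1.prodMk_nhds h2
      refine h12.congr' (Filter.Eventually.of_forall fun s => ?_) |>.mono_right (le_of_eq ?_)
      · simp only [Function.comp_apply, Units.embedProduct_apply, hm_val, hm_inv]
      · simp only [Units.embedProduct_apply, hm_val, hm_inv]
    have hm0 : m s₀ = 1 := by
      refine Subtype.ext (Units.ext ?_)
      rw [hm_val, hMf0]; rfl
    have htend : Tendsto m (𝓝 s₀) (𝓝 1) := by rw [← hm0]; exact hm_cont
    have hev := htend.eventually (G.eventually_nhds_one_log_mem hreg hleft)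
    -- smallness for the skew-Hermitian argument: `L s`, `star (L s)` and `-L s` in the `log ∘ exp = id` neighbourhood
    have hL_cont : ContinuousAt (fun s => log (Mf s)) s₀ := by
      have := hlog.continuousAt
      rw [← hMf0] at this
      exact this.comp hval_cont
    have hL0 : log (Mf s₀) = 0 := by rw [hMf0, hlog1]
    have htendL : Tendsto (fun s => log (Mf s)) (𝓝 s₀) (𝓝 0) := by rw [← hL0]; exact hL_cont
    have hev_star : ∀ᶠ s in 𝓝 s₀, log (NormedSpace.exp (star (log (Mf s)))) = star (log (Mf s)) := by
      have ht : Tendsto (fun s => star (log (Mf s))) (𝓝 s₀) (𝓝 0) := by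
        have := (continuous_star.tendsto (0 : Matrix N N A)).comp htendL
        rwa [star_zero] at this
      exact ht.eventually hleft
    have hev_neg : ∀ᶠ s in 𝓝 s₀, log (NormedSpace.exp (-(log (Mf s)))) = -log (Mf s) := by
      have ht : Tendsto (fun s => -log (Mf s)) (𝓝 s₀) (𝓝 0) := by
        have := (continuous_neg.tendsto (0 : Matrix N N A)).comp htendL
        rwa [neg_zero] at this
      exact ht.eventually hleft
    filter_upwards [hev, hev_star, hev_neg] with s hs hstar hneg
    -- `hs : log (Mf s) ∈ 𝔤 ∧ expGL (log (Mf s)) = m s`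
    rw [hm_val] at hs
    have hexp : NormedSpace.exp (log (Mf s)) = Mf s := by
      have := congrArg (fun u : GL N A => (u : Matrix N N A)) hs.2
      simpa only [coe_expGL, hm_val] using this
    -- skew-Hermitian
    have hskew : star (log (Mf s)) = -log (Mf s) := by
      have h1 : NormedSpace.exp (star (log (Mf s))) = NormedSpace.exp (-(log (Mf s))) := by
        rw [← NormedSpace.star_exp, Matrix.exp_neg, hexp]
        exact (Matrix.inv_eq_left_inv (hunit s)).symm
      rw [← hstar, h1, hneg]
    have hmem : log (Mf s) ∈ G.compactLie := (G.mem_compactLie_iff _).mpr ⟨hs.1, hskew⟩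
    refine ⟨hmem, ?_⟩
    -- `k s = k s₀ * expK (L s)`: compare in `GL N A`
    have hGL : ((G.expK ⟨log (Mf s), hmem⟩ : G.maximalCompact) : GL N A) = ((k s₀)⁻¹ * k s : G.maximalCompact) := by
      rw [RealMatrixGroup.coe_expK]
      exact hs.2
    have : G.expK ⟨log (Mf s), hmem⟩ = (k s₀)⁻¹ * k s := Subtype.ext hGL
    rw [this, mul_inv_cancel_left]

/-- **The left log-derivative of a `K`-valued curve lies in `𝔨`**: if the matrix of `k : ℝ → K` has derivative `k'` at `s₀` then
`k(s₀)⁻¹ k' ∈ 𝔨` (it is the derivative at `s₀` of the `𝔨`-valued logarithm `L` of `exists_log_curve'`, and `𝔨` is closed).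
[cite: Hall2015, Cor. 3.44] [cite: Knapp2002, I.§10 Prop. 1.89] -/
theorem inv_mul_deriv_mem_compactLie (hreg : ∀ X : Matrix N N A, (∀ t : ℝ, expGL (t • X) ∈ G.carrier) → X ∈ G.lie)
    {k : ℝ → G.maximalCompact} {s₀ : ℝ} {k' : Matrix N N A}
    (hk : HasDerivAt (fun s => (((k s : G.maximalCompact) : GL N A) : Matrix N N A)) k' s₀) :
    ((((k s₀)⁻¹ : G.maximalCompact) : GL N A) : Matrix N N A) * k' ∈ G.compactLie := by
  -- Mathlib idiom (Mathlib/Algebra/Lie/OfAssociative.lean), needed to name `𝔨.toSubmodule`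
  letI : LieRing (Matrix N N A) := LieRing.ofAssociativeRing
  obtain ⟨L, hL0, hL', hev⟩ := exists_log_curve' (G := G) hreg hk
  -- the difference quotients of `L` lie in the closed subspace `𝔨` eventually, hence so does the derivative
  have hclosed : IsClosed (G.compactLie.toSubmodule : Set (Matrix N N A)) := Submodule.closed_of_finiteDimensional _
  have ht : Tendsto (slope L s₀) (𝓝[≠] s₀) (𝓝 (((((k s₀)⁻¹ : G.maximalCompact) : GL N A) : Matrix N N A) * k')) :=
    hL'.tendsto_slope
  refine hclosed.mem_of_tendsto ht ?_
  have hev' : ∀ᶠ s in 𝓝[≠] s₀, ∃ hL : L s ∈ G.compactLie, k s = k s₀ * G.expK ⟨L s, hL⟩ := nhdsWithin_le_nhds hev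
  filter_upwards [hev'] with s hs
  obtain ⟨hLs, -⟩ := hs
  rw [slope_def_module, hL0, sub_zero]
  exact G.compactLie.toSubmodule.smul_mem _ hLs

/-- **The logarithm of a `K`-valued curve, log-derivative form**: if the matrix of `k` has derivative `k(s₀) · Y` at `s₀` with `Y ∈ 𝔨`, the
logarithm `L` of `exists_log_curve'` has `HasDerivAt L Y s₀`. [cite: Hall2015, Cor. 3.44] -/
theorem exists_log_curve (hreg : ∀ X : Matrix N N A, (∀ t : ℝ, expGL (t • X) ∈ G.carrier) → X ∈ G.lie)
    {k : ℝ → G.maximalCompact} {s₀ : ℝ} {Y : G.compactLie}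
    (hk : HasDerivAt (fun s => (((k s : G.maximalCompact) : GL N A) : Matrix N N A))
      ((((k s₀ : G.maximalCompact) : GL N A) : Matrix N N A) * (Y : Matrix N N A)) s₀) :
    ∃ L : ℝ → Matrix N N A, L s₀ = 0 ∧ HasDerivAt L (Y : Matrix N N A) s₀ ∧
      ∀ᶠ s in 𝓝 s₀, ∃ hL : L s ∈ G.compactLie, k s = k s₀ * G.expK ⟨L s, hL⟩ := by
  obtain ⟨L, hL0, hL', hev⟩ := exists_log_curve' (G := G) hreg hk
  refine ⟨L, hL0, ?_, hev⟩
  have hPK : ((((k s₀)⁻¹ : G.maximalCompact) : GL N A) : Matrix N N A) * (((k s₀ : G.maximalCompact) : GL N A) : Matrix N N A) = 1 := by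
    rw [← Units.val_mul, ← Subgroup.coe_mul, inv_mul_cancel]; rfl
  rwa [← mul_assoc, hPK, one_mul] at hL'


omit [StarModule ℝ A] [ContinuousStar A] in
/-- **The logarithm of a `G`-valued curve** (the `G.carrier` twin of `exists_log_curve'`): for a regular linear real group over a
finite-dimensional coefficient algebra and a curve `g : ℝ → G` whose matrix has derivative `g′` at `s₀`, `L s := log (g(s₀)⁻¹ g(s))` satisfies
`L s₀ = 0`, `HasDerivAt L (g(s₀)⁻¹ g′) s₀`, and for `s` near `s₀`: `L s ∈ 𝔤` and `g s = g s₀ · expMem (L s)` (GL-continuity of the curve from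
`NormedRing.inverse_continuousAt`). [cite: Hall2015, Cor. 3.44] [cite: Knapp2002, I.§10 Prop. 1.89] -/
theorem exists_log_curve_carrier (hreg : ∀ X : Matrix N N A, (∀ t : ℝ, expGL (t • X) ∈ G.carrier) → X ∈ G.lie)
    {g : ℝ → G.carrier} {s₀ : ℝ} {g' : Matrix N N A}
    (hg : HasDerivAt (fun s => (((g s : G.carrier) : GL N A) : Matrix N N A)) g' s₀) :
    ∃ L : ℝ → Matrix N N A, L s₀ = 0 ∧
      HasDerivAt L (((((g s₀)⁻¹ : G.carrier) : GL N A) : Matrix N N A) * g') s₀ ∧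
      ∀ᶠ s in 𝓝 s₀, ∃ hL : L s ∈ G.lie, g s = g s₀ * G.expMem ⟨L s, hL⟩ := by
  obtain ⟨log, hlog, hlog1, -, hleft⟩ := exists_contDiffAt_log_inverse (A := A) (N := N)
  set P : Matrix N N A := ((((g s₀)⁻¹ : G.carrier) : GL N A) : Matrix N N A) with hP
  set Mf : ℝ → Matrix N N A := fun s => P * (((g s : G.carrier) : GL N A) : Matrix N N A) with hMf
  have hPK : P * (((g s₀ : G.carrier) : GL N A) : Matrix N N A) = 1 := by
    rw [hP, ← Units.val_mul, ← Subgroup.coe_mul, inv_mul_cancel]; rfl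
  have hMf0 : Mf s₀ = 1 := hPK
  have hMf' : HasDerivAt Mf (P * g') s₀ := hg.const_mul P
  refine ⟨fun s => log (Mf s), by show log (Mf s₀) = 0; rw [hMf0, hlog1], ?_, ?_⟩
  · have hlog' := hasFDerivAt_log_one hlog hleft
    rw [← hMf0] at hlog'
    exact (hlog'.comp_hasDerivAt s₀ hMf').congr_deriv rfl
  · have hval_cont : ContinuousAt Mf s₀ := hMf'.continuousAt
    let m : ℝ → G.carrier := fun s => (g s₀)⁻¹ * g s
    have hm_val : ∀ s, (((m s : G.carrier) : GL N A) : Matrix N N A) = Mf s := fun s => by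
      simp only [m, hMf, hP, Subgroup.coe_mul, Units.val_mul]
    have hm_inv : ∀ s, ((((m s : G.carrier) : GL N A)⁻¹ : GL N A) : Matrix N N A) = Ring.inverse (Mf s) := fun s => by
      rw [← hm_val, Ring.inverse_unit]
    have hm_cont : ContinuousAt m s₀ := by
      show Tendsto m (𝓝 s₀) (𝓝 (m s₀))
      have hind : IsInducing (fun g : G.carrier => Units.embedProduct (Matrix N N A) (g : GL N A)) :=
        Units.isInducing_embedProduct.comp ⟨rfl⟩
      rw [hind.nhds_eq_comap, Filter.tendsto_comap_iff]
      have h1 : Tendsto (fun s => Mf s) (𝓝 s₀) (𝓝 (Mf s₀)) := hval_cont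
      have hinv0 : ContinuousAt Ring.inverse (Mf s₀) := by
        rw [← hm_val]; exact NormedRing.inverse_continuousAt _
      have h2 : Tendsto (fun s => MulOpposite.op (Ring.inverse (Mf s))) (𝓝 s₀) (𝓝 (MulOpposite.op (Ring.inverse (Mf s₀)))) :=
        (MulOpposite.continuous_op.tendsto _).comp (hinv0.tendsto.comp hval_cont)
      have h12 := h1.prodMk_nhds h2
      refine h12.congr' (Filter.Eventually.of_forall fun s => ?_) |>.mono_right (le_of_eq ?_)
      · simp only [Function.comp_apply, Units.embedProduct_apply, hm_val, hm_inv]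
      · simp only [Units.embedProduct_apply, hm_val, hm_inv]
    have hm0 : m s₀ = 1 := by simp only [m, inv_mul_cancel]
    have htend : Tendsto m (𝓝 s₀) (𝓝 1) := by rw [← hm0]; exact hm_cont
    have hev := htend.eventually (G.eventually_nhds_one_log_mem hreg hleft)
    filter_upwards [hev] with s hs
    rw [hm_val] at hs
    refine ⟨hs.1, ?_⟩
    have hGL : ((G.expMem ⟨log (Mf s), hs.1⟩ : G.carrier) : GL N A) = ((g s₀)⁻¹ * g s : G.carrier) := by
      rw [RealMatrixGroup.coe_expMem]
      exact hs.2
    have : G.expMem ⟨log (Mf s), hs.1⟩ = (g s₀)⁻¹ * g s := Subtype.ext hGL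
    rw [this, mul_inv_cancel_left]

omit [StarModule ℝ A] [ContinuousStar A] in
/-- **The left log-derivative of a `G`-valued curve lies in `𝔤`**: if the matrix of `g : ℝ → G` has derivative `g′` at `s₀` then
`g(s₀)⁻¹ g′ ∈ 𝔤`. [cite: Hall2015, Cor. 3.44] [cite: Knapp2002, I.§10 Prop. 1.89] -/
theorem inv_mul_deriv_mem_lie (hreg : ∀ X : Matrix N N A, (∀ t : ℝ, expGL (t • X) ∈ G.carrier) → X ∈ G.lie)
    {g : ℝ → G.carrier} {s₀ : ℝ} {g' : Matrix N N A}
    (hg : HasDerivAt (fun s => (((g s : G.carrier) : GL N A) : Matrix N N A)) g' s₀) :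
    ((((g s₀)⁻¹ : G.carrier) : GL N A) : Matrix N N A) * g' ∈ G.lie := by
  -- Mathlib idiom (Mathlib/Algebra/Lie/OfAssociative.lean), needed to name `𝔤.toSubmodule`
  letI : LieRing (Matrix N N A) := LieRing.ofAssociativeRing
  obtain ⟨L, hL0, hL', hev⟩ := exists_log_curve_carrier (G := G) hreg hg
  have hclosed : IsClosed (G.lie.toSubmodule : Set (Matrix N N A)) := Submodule.closed_of_finiteDimensional _
  have ht : Tendsto (slope L s₀) (𝓝[≠] s₀) (𝓝 (((((g s₀)⁻¹ : G.carrier) : GL N A) : Matrix N N A) * g')) := hL'.tendsto_slope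
  refine hclosed.mem_of_tendsto ht ?_
  have hev' : ∀ᶠ s in 𝓝[≠] s₀, ∃ hL : L s ∈ G.lie, g s = g s₀ * G.expMem ⟨L s, hL⟩ := nhdsWithin_le_nhds hev
  filter_upwards [hev'] with s hs
  obtain ⟨hLs, -⟩ := hs
  rw [slope_def_module, hL0, sub_zero]
  exact G.lie.toSubmodule.smul_mem _ hLs

end LogChart


end IsGKModule

end Literature.NumberTheory.Automorphic

end
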